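import Mathlib
import Literature.Probability.Percolation.BlockResampling
import Literature.Probability.Percolation.InfiniteClusterDensity
import HarnessLib

/-!
# `stub_cap` of line `SketchIdeator1` (crux `TetrahedronHarrisGap`, stmt-CriticalPhenomena-7799):
# a bulk-conditional hook probability is at most the square of the one-arm probability

Registered stub `stub_cap` of the lead's skeleton `Cruxes/TetrahedronHarrisGap/Lines/SketchIdeator1.lean`
(card `corner-ball-total-covariance`), DEF-FREE over tree declarations.

Write `T_r = {0, a = (r,r,0), b = (r,0,r), c = (0,r,r)} ⊂ ℤ³`, `m = r / 8`, and let
`K = armEdges m 0 ∪ armEdges m a ∪ armEdges m b ∪ armEdges m c` be the lattice edges touching one of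
the four corner boxes of sup-radius `m` (`armEdges`, `InfiniteClusterDensity.lean`).  For a lattice
configuration `ω` the bulk-conditional hook probability
`f(ω) = blockCondProb K (openConn 0 a) ω = P_p{ζ | ω ∖ K ∪ obs ζ K ∈ openConn 0 a}`
(`blockCondProb_eq_real`, `BlockResampling.lean`) is the probability that `0 ↔ a` once the corner
coordinates are re-drawn.  If `0 ↔ a` in the glued configuration `ω' = ω ∖ K ∪ obs ζ K` (again a
lattice configuration), then, `a` lying outside `0 + B(m)` and `0` outside `a + B(m)`, the cluster of
`0` leaves `0 + B(m)` and the cluster of `a` leaves `a + B(m)` (`boxArm_of_not_subset` after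
translating to the origin): `ω' ∈ armAt m 0 ∩ armAt m a`.  These arm events are determined by
`armEdges m 0, armEdges m a ⊆ K` (`determinedBy_armAt`), on which `ω'` agrees with `ζ`; so
`f(ω) ≤ P_p(armAt m 0 ∩ armAt m a) = P_p(armAt m 0) · P_p(armAt m a)` (the two corner edge sets are
disjoint, `bondPercolation_real_inter_of_disjoint`) `= P_p(boxArm (m+1) 0)²` (`measureReal_armAt`).
The same argument caps `g(ω) = blockCondProb K (openConn b c) ω`.

Main results:
* `blockCondProb_openConn_le_sq` — the generic cap on `ℤ^d`: for a lattice block `K` containing two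
  disjoint corner edge sets `armEdges m x`, `armEdges m y` with `y - x, x - y ∉ B(m)`,
  `blockCondProb K (openConn x y) ω ≤ P_p(boxArm (m+1) 0)²`;
* `stub_cap` — the registered signature (the two opposite edges `(0, a)` and `(b, c)` of `T_r`,
  `m = r / 8`, `r ≥ 16`; the corners of a pair are at sup-distance `r > 2(m+1)` in some coordinate).
-/

noncomputable section

namespace Summit.CriticalPhenomena.PercolationContinuityZ3.Theorems.TetrahedronHarrisGap

open MeasureTheory
open Literature.Probability.Percolation Literature.Probability.LatticeModels

variable {d : ℕ}

/-! ## Hooks force arms -/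

/-- `{x ↔ y} = {y ↔ x}` (membership form). -/
theorem mem_openConn_comm {x y : Site d} {ω : BondConfig (Site d)} :
    ω ∈ openConn x y ↔ ω ∈ openConn y x :=
  ⟨fun h => SimpleGraph.Reachable.symm h, fun h => SimpleGraph.Reachable.symm h⟩

/-- A lattice configuration in which `x ↔ y` with `y ∉ x + B(m)` has an arm from `x` out of
`x + B(m)`, i.e. lies in `armAt m x` (translate to the origin; the cluster of `0` contains `y - x ∉ B(m)`,
so `boxArm_of_not_subset` applies). -/
theorem armAt_of_mem_openConn {m : ℕ} {x y : Site d} {ω : BondConfig (Site d)}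
    (hω : ω ⊆ (zdGraph d).edgeSet) (hconn : ω ∈ openConn x y)
    (hfar : y - x ∉ (↑(box d m) : Set (Site d))) : ω ∈ armAt m x := by
  rw [mem_armAt_iff]
  refine boxArm_of_not_subset (toOrigin_subset_edgeSet hω) ?_ ?_
  · simp only [Nat.add_sub_cancel, Finset.mem_coe]
    exact zero_mem_box d m
  · -- `y - x` lies in the cluster of `0` in the translated configuration
    have h : ω ∈ BondConfig.relabel (sym2Equiv (Site.shift (-x))) ⁻¹'
        (openConn (x + -x) (y + -x) : Set (BondConfig (Site d))) := by
      rw [preimage_relabel_shift_openConn]; exact hconn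
    rw [Set.mem_preimage, add_neg_cancel, ← sub_eq_add_neg] at h
    intro hsub
    rw [Nat.add_sub_cancel] at hsub
    exact hfar (hsub h)

/-- Gluing: if `armEdges m x ⊆ K`, the glued configuration `ω ∖ K ∪ obs ζ K` agrees with `ζ` on
`armEdges m x`. -/
theorem sdiff_union_obs_inter_armEdges {m : ℕ} {x : Site d} {K : Finset (Sym2 (Site d))}
    (hxK : armEdges m x ⊆ K) (ω ζ : BondConfig (Site d)) :
    (ω \ ↑K ∪ ↑(obs ζ K)) ∩ ↑(armEdges m x) = ζ ∩ ↑(armEdges m x) := by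
  ext e
  simp only [Set.mem_inter_iff, Set.mem_union, Set.mem_sdiff, Finset.mem_coe, mem_obs_iff]
  constructor
  · rintro ⟨⟨-, heK⟩ | ⟨-, heζ⟩, heA⟩
    · exact absurd (hxK heA) heK
    · exact ⟨heζ, heA⟩
  · rintro ⟨heζ, heA⟩
    exact ⟨Or.inr ⟨hxK heA, heζ⟩, heA⟩

/-- **A hook across the block forces an arm of the re-drawn corner block.** For a lattice
configuration `ω` and a lattice block `K` containing `armEdges m x`: if `x ↔ y` in the glued
configuration `ω ∖ K ∪ obs ζ K` and `y ∉ x + B(m)`, then `ζ ∈ armAt m x` (the glued configuration is a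
lattice configuration lying in `armAt m x`, an event determined by `armEdges m x`, where it agrees
with `ζ`). -/
theorem armAt_of_sdiff_union_obs_mem_openConn {m : ℕ} {x y : Site d} {K : Finset (Sym2 (Site d))}
    {ω ζ : BondConfig (Site d)} (hω : ω ⊆ (zdGraph d).edgeSet)
    (hK : (↑K : Set (Sym2 (Site d))) ⊆ (zdGraph d).edgeSet) (hxK : armEdges m x ⊆ K)
    (hfar : y - x ∉ (↑(box d m) : Set (Site d)))
    (hconn : ω \ ↑K ∪ ↑(obs ζ K) ∈ openConn x y) : ζ ∈ armAt m x := by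
  have hω' : ω \ ↑K ∪ ↑(obs ζ K) ⊆ (zdGraph d).edgeSet := by
    refine Set.union_subset (Set.sdiff_subset.trans hω) ?_
    exact (Finset.coe_subset.2 (obs_subset ζ K)).trans hK
  have harm : ω \ ↑K ∪ ↑(obs ζ K) ∈ armAt m x := armAt_of_mem_openConn hω' hconn hfar
  exact ((determinedBy_iff _ _).1 (determinedBy_armAt m x) _ _
    (sdiff_union_obs_inter_armEdges hxK ω ζ)).1 harm

/-! ## The generic cap -/

/-- **The hook cap (generic form on `ℤ^d`).** Let `ω` be a lattice configuration and `K` a block of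
lattice edges containing the corner edge sets `armEdges m x` and `armEdges m y`, these two being
disjoint, with `y ∉ x + B(m)` and `x ∉ y + B(m)`.  Then the bulk-conditional hook probability
`P_p(x ↔ y | ω off K)` is at most `P_p(boxArm (m+1) 0)²`: by `blockCondProb_eq_real` it is the
probability of those `ζ` whose gluing into `ω` joins `x` to `y`, all of which lie in
`armAt m x ∩ armAt m y`, an intersection of independent events each of probability `P_p(boxArm (m+1) 0)`. -/
theorem blockCondProb_openConn_le_sq (p : unitInterval) (m : ℕ) (K : Finset (Sym2 (Site d)))
    (x y : Site d) (ω : BondConfig (Site d)) (hω : ω ⊆ (zdGraph d).edgeSet)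
    (hK : (↑K : Set (Sym2 (Site d))) ⊆ (zdGraph d).edgeSet)
    (hxK : armEdges m x ⊆ K) (hyK : armEdges m y ⊆ K)
    (hdisj : Disjoint (armEdges m x) (armEdges m y))
    (hxy : y - x ∉ (↑(box d m) : Set (Site d))) (hyx : x - y ∉ (↑(box d m) : Set (Site d))) :
    blockCondProb (zdGraph d) p K (openConn x y) ω ≤
      (bondPercolation (zdGraph d) p).real (boxArm (m + 1) (0 : Site d)) ^ 2 := by
  have hsub : {ζ : BondConfig (Site d) | ω \ ↑K ∪ ↑(obs ζ K) ∈ openConn x y} ⊆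
      armAt m x ∩ armAt m y := fun ζ hζ =>
    ⟨armAt_of_sdiff_union_obs_mem_openConn hω hK hxK hxy hζ,
      armAt_of_sdiff_union_obs_mem_openConn hω hK hyK hyx (mem_openConn_comm.1 hζ)⟩
  calc blockCondProb (zdGraph d) p K (openConn x y) ω
      = (bondPercolation (zdGraph d) p).real {ζ | ω \ ↑K ∪ ↑(obs ζ K) ∈ openConn x y} :=
        blockCondProb_eq_real _ p K _ ω
    _ ≤ (bondPercolation (zdGraph d) p).real (armAt m x ∩ armAt m y) := measureReal_mono hsub
    _ = (bondPercolation (zdGraph d) p).real (armAt m x) *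
          (bondPercolation (zdGraph d) p).real (armAt m y) :=
        bondPercolation_real_inter_of_disjoint _ p (Finset.disjoint_coe.2 hdisj)
          (determinedBy_armAt m x) (determinedBy_armAt m y) (measurableSet_armAt m x)
          (measurableSet_armAt m y)
    _ = (bondPercolation (zdGraph d) p).real (boxArm (m + 1) (0 : Site d)) ^ 2 := by
        rw [measureReal_armAt, measureReal_armAt, sq]

/-! ## Geometry of the corner blocks -/

/-- Every endpoint of an edge of `armEdges m x` lies within sup-distance `m + 1` of `x` (one endpoint
of the translated edge lies in `B(m)`, and lattice edges have sup-length `1`). -/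
theorem apply_sub_le_of_mem_armEdges {m : ℕ} {x : Site d} :
    ∀ {e : Sym2 (Site d)}, e ∈ armEdges m x → ∀ u ∈ e, ∀ i : Fin d,
      -((m : ℤ) + 1) ≤ u i - x i ∧ u i - x i ≤ (m : ℤ) + 1 := by
  intro e
  induction e using Sym2.ind with
  | h a b =>
    intro he u hu i
    rw [mem_armEdges_iff, mem_edgesTouching_iff] at he
    obtain ⟨hadj, z, hz, hze⟩ := he
    simp only [sym2Equiv_apply, Sym2.map_mk, SimpleGraph.mem_edgeSet, Site.shift_apply] at hadj hze
    have h1 := zdGraph_adj_apply_le hadj i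
    simp only [Pi.add_apply, Pi.neg_apply] at h1
    rw [mem_box] at hz
    have h2 := hz i
    rw [Sym2.mem_iff] at hze hu
    rcases hze with rfl | rfl <;> rcases hu with rfl | rfl <;>
      simp only [Pi.add_apply, Pi.neg_apply] at h2 <;> omega

/-- Corner edge sets around two vertices more than `2m + 2` apart in some coordinate are disjoint. -/
theorem disjoint_armEdges {m : ℕ} {x y : Site d} {i : Fin d}
    (h : 2 * (m : ℤ) + 2 < y i - x i) : Disjoint (armEdges m x) (armEdges m y) := by
  rw [Finset.disjoint_left]
  intro e hex hey
  have h1 := apply_sub_le_of_mem_armEdges hex _ (Sym2.out_fst_mem e) i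
  have h2 := apply_sub_le_of_mem_armEdges hey _ (Sym2.out_fst_mem e) i
  omega

/-! ## The registered stub -/

/-- **stub_cap** (hook cap). For a lattice configuration `ω` and `r ≥ 16`, the bulk-conditional hook
probabilities of the two opposite edges `(0, a_r)` and `(b_r, c_r)` of
`T_r = {0, a_r = (r,r,0), b_r = (r,0,r), c_r = (0,r,r)}`, given the configuration off the four corner
blocks `K_r = armEdges (r/8) 0 ∪ armEdges (r/8) a_r ∪ armEdges (r/8) b_r ∪ armEdges (r/8) c_r`, are at
most `π_r² = P_p(boxArm (r/8+1) 0)²`: a hook from a corner must leave the corner box of radius `r/8`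
through coordinates of that corner's block, and the two corner blocks of a pair are disjoint (the
corners are at sup-distance `r > 2(r/8 + 1)`), hence independent. -/
theorem stub_cap :
    ∀ (p : unitInterval) (r : ℕ), 16 ≤ r → ∀ ω : BondConfig (Site 3), ω ⊆ (zdGraph 3).edgeSet →
      blockCondProb (zdGraph 3) p
          (armEdges (r / 8) (0 : Site 3) ∪ armEdges (r / 8) ![(r : ℤ), (r : ℤ), 0] ∪
            armEdges (r / 8) ![(r : ℤ), 0, (r : ℤ)] ∪ armEdges (r / 8) ![0, (r : ℤ), (r : ℤ)])
          (openConn (0 : Site 3) ![(r : ℤ), (r : ℤ), 0]) ω ≤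
        (bondPercolation (zdGraph 3) p).real (boxArm (r / 8 + 1) (0 : Site 3)) ^ 2 ∧
      blockCondProb (zdGraph 3) p
          (armEdges (r / 8) (0 : Site 3) ∪ armEdges (r / 8) ![(r : ℤ), (r : ℤ), 0] ∪
            armEdges (r / 8) ![(r : ℤ), 0, (r : ℤ)] ∪ armEdges (r / 8) ![0, (r : ℤ), (r : ℤ)])
          (openConn ![(r : ℤ), 0, (r : ℤ)] ![0, (r : ℤ), (r : ℤ)]) ω ≤
        (bondPercolation (zdGraph 3) p).real (boxArm (r / 8 + 1) (0 : Site 3)) ^ 2 := by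
  intro p r hr ω hω
  -- the scale `m = r / 8`; all that is used below is `2m + 2 < r`
  set m : ℕ := r / 8 with hm
  have hmr : 2 * (m : ℤ) + 2 < r := by omega
  -- the block consists of lattice edges
  have hK : (↑(armEdges m (0 : Site 3) ∪ armEdges m ![(r : ℤ), (r : ℤ), 0] ∪
      armEdges m ![(r : ℤ), 0, (r : ℤ)] ∪ armEdges m ![0, (r : ℤ), (r : ℤ)]) : Set (Sym2 (Site 3))) ⊆
      (zdGraph 3).edgeSet := by
    intro e he
    simp only [Finset.coe_union, Set.mem_union, Finset.mem_coe] at he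
    rcases he with ((he | he) | he) | he <;> exact armEdges_subset_edgeSet _ _ (Finset.mem_coe.2 he)
  refine ⟨blockCondProb_openConn_le_sq p m _ _ _ ω hω hK ?_ ?_ ?_ ?_ ?_,
    blockCondProb_openConn_le_sq p m _ _ _ ω hω hK ?_ ?_ ?_ ?_ ?_⟩
  · -- `armEdges m 0 ⊆ K`
    exact Finset.subset_union_left.trans (Finset.subset_union_left.trans Finset.subset_union_left)
  · -- `armEdges m a ⊆ K`
    exact Finset.subset_union_right.trans (Finset.subset_union_left.trans Finset.subset_union_left)
  · -- the corner blocks of `0` and `a` are disjoint: `a₀ - 0 = r > 2m + 2`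
    refine disjoint_armEdges (i := 0) ?_
    simp only [Pi.zero_apply, sub_zero, Matrix.cons_val_zero]
    exact hmr
  · -- `a - 0 ∉ B(m)`
    intro h
    rw [Finset.mem_coe, mem_box] at h
    have := h 0
    simp only [Pi.sub_apply, Pi.zero_apply, sub_zero, Matrix.cons_val_zero] at this
    omega
  · -- `0 - a ∉ B(m)`
    intro h
    rw [Finset.mem_coe, mem_box] at h
    have := h 0
    simp only [Pi.sub_apply, Pi.zero_apply, zero_sub, Matrix.cons_val_zero] at this
    omega
  · -- `armEdges m b ⊆ K`
    exact Finset.subset_union_right.trans Finset.subset_union_left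
  · -- `armEdges m c ⊆ K`
    exact Finset.subset_union_right
  · -- the corner blocks of `b` and `c` are disjoint: `c₁ - b₁ = r > 2m + 2`
    refine disjoint_armEdges (i := 1) ?_
    simp only [sub_zero, Matrix.cons_val_zero, Matrix.cons_val_one]
    exact hmr
  · -- `c - b ∉ B(m)`
    intro h
    rw [Finset.mem_coe, mem_box] at h
    have := h 0
    simp only [Pi.sub_apply, zero_sub, Matrix.cons_val_zero] at this
    omega
  · -- `b - c ∉ B(m)`
    intro h
    rw [Finset.mem_coe, mem_box] at h
    have := h 0
    simp only [Pi.sub_apply, sub_zero, Matrix.cons_val_zero] at this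
    omega

end Summit.CriticalPhenomena.PercolationContinuityZ3.Theorems.TetrahedronHarrisGap

end
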